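import Summits.AtomisticToContinuum.FouriersLaw.Theses.JunctionLocality
import Literature.MathematicalPhysics.KineticTheory.LangevinChainKernel
import Literature.MathematicalPhysics.KineticTheory.LangevinChainGibbs
import Literature.Probability.Entropy.StrongDataProcessing

/-!
# Line `transit-entropy-pairing` — checked skeleton for crux `NonBallistic`
(stmt-AtomisticToContinuum-9127; routes JunctionLocality (primary, rank 3) / PuiseuxTransferLedger (rank 3) /
BondHeatUncertainty (support) — one shared decl text; crux-plan round 1, 2026-08-16)

Idea card `transit-entropy-pairing` (crux-ideate r1 ideator 1; triage r1: pass ×3, merge-twin of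
`drude-controls-conductance`). LEVER: compare, on path space over `[0, τ]`, the stationary two-temperature
process `P^δ` (baths `T ± δ/2`, friction `γ`, start `μ_δ`) with the EQUAL-NOISE EQUILIBRIUM REFERENCE `Q^δ`
(start Gibbs `π_T`, bath `c` with the SAME noise amplitude `2γT_c` but friction `γT_c/T`, so that `π_T` is
invariant): Girsanov is legal (equal diffusion coefficients), the drift difference is `∓γδp_c/(2T)` and the
path likelihood ratio factorises as `(dμ_δ/dπ_T)(x_0) · Z_τ`. The Hammersley–Chapman–Robbins (order-`δ²`
Cramér–Rao) inequality for the time-integrated TOTAL current `Φ_τ = ∫₀^τ J_tot` — mean `τ·δ·D_N(1+o(1))` under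
`P^δ`, mean `0` under `Q^δ` — then reads, after division by `δ²` and `δ → 0`,

  `(D_N τ)² ≤ Var_eq(Φ_τ) · (F_N + γτ/(4T²))`,   `F_N := limsup_δ δ⁻² χ²(μ_δ ‖ π_T) = ‖h_N‖²_{L²(π_T)}`

(`h_N` the full linear-response density; `γτ/(4T²) = 2 · Σ_c (γ/2T)² · τ · T/(2γT)` the path part of the
Fisher information — the triagers' `2(K'_N + γτ/8T²)` with `F_N = 2K'_N`). No fluctuation theorem, no
exponential moments of `Φ_τ` (which do not exist for the quartic coupling), no time-reversal bookkeeping.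
PAIRING: with an EXTENSIVE static budget `F_N ≤ F·N` the entropy term and the dissipation term balance at
the transit scale `τ ≍ N`, so for every window `τ ≤ aN`

  `G_N² = (D_N/(N-1))² ≲ (Var_eq(Φ_τ)/(N τ²)) · (F + γa/(4T²))`,

and the crux `liminf_N G_N = 0` follows from ONE sub-ballistic equilibrium variance `Var_eq(Φ_τ) ≤ εNτ²` at
some `τ ≤ aN` for all large `N` — the transferred crux `stub_subballisticTransitWindow` (zero finite-time /
Cesàro-2 Drude weight of the pinned anharmonic chain, read on the open chain; FALSE for the harmonic member,
where `Var_eq(Φ_τ) ≳ c(a)·N·τ²` up to `τ = aN` through the odd Toeplitz charge `Q₁ = 2J̃`).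

Four registered stubs (`stub_*`, the only `sorry`s) and the kernel-checked composition
`NonBallistic_of : stub₁ → stub₂ → stub₃ → stub₄ → JunctionLocality.NonBallistic` (real proof: one filter
step and real arithmetic), hypotheses keyed by the stub names (`Registered.stub_*` = verbatim statements),
plus the wiring `example`. Statements are `let`-free; the equilibrium total-current autocorrelation
`C_N(s) = ∫ J_tot · (P_s J_tot) dπ_T` (constructed `transitionKernel` at equal bath temperatures `T`,
`gibbsMeasure`) enters through a function variable `C` pinned by a defining equation, exactly the object of
BondHeatUncertainty's (S)/(★) summed over bonds, and `Var_eq(Φ_τ) = 2∫₀^τ (τ-s) C_N(s) ds`.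
Line card: `Lines/transit-entropy-pairing.md` (this file is published as `Lines/transit_entropy_pairing.lean`).

Disproof.lean (cdisprove v1–v3, read through its item notes — the evidence store is not mounted in planner
jails) honoured: `not_nonBallisticFor_harmonic` (anharmonicity load-bearing) — stubs 1–3 hold verbatim for
the harmonic member (checked numerically by the triage panel, GIR column of j010530 / T2's table), ALL the
anharmonic content sits in `stub_subballisticTransitWindow`, which fails at `lam = β = 0` as it must;
`nonBallistic_iff_temperature_one` (scaling conjugacy, `N₀(ε,T) → ∞` as `T ↓ 0`) — no stub is a certificate
at one parameter point: stub 4 is a `∀ (ω₂, lam, β, γ, T)` statement with `N₀ = N₀(ε, parameters)` free to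
blow up; `nonBallistic_of_fouriersLaw` (necessity) — consistent: under Fourier behaviour
`Var_eq(Φ_τ)/(Nτ²) ≈ 2T²κ/τ`, so stub 4 holds with `τ = τ(ε)` fixed. No `Negative/` lemma has landed for
this crux (nothing to import); no stub instantiates a statement of the negatives index.
-/

noncomputable section

namespace Summit.AtomisticToContinuum.FouriersLaw.Cruxes.NonBallistic.TransitEntropyPairing

open MeasureTheory Filter Topology
open scoped NNReal ENNReal BigOperators
open Literature.MathematicalPhysics.KineticTheory.HeatConduction

/-! ## Registered stubs (the only `sorry`s of the line) -/

/-- **stub 1 · `stub_autocorrelationContinuous` — fixed-`N` regularity of the equilibrium total-current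
autocorrelation (size M; shared infrastructure with the twin line and with BondHeatUncertainty (S)/(★)).**
For the pinned chain (all parameters `> 0`), `T > 0` and every `N`, the equilibrium autocorrelation
`s ↦ C_N(s) = ∫ J_tot(x) · E_x[J_tot(X_s)] dπ_T(x)` of the total current `J_tot = Σ_i j_i` under the
constructed equal-temperature kernels is CONTINUOUS on `ℝ` (constant `= Var_π(J_tot)`-value for `s ≤ 0` by
`Real.toNNReal`). This is what makes the crux-side variance `2∫₀^τ(τ-s)C_N(s)ds` an honest (not Bochner-junk)
integral — the triage panel's junk warning on every path-space bridge (T2 sharpen on C2). Expected proof: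
continuity of the flow in time (`pinnedChain_continuous_solMap`), polynomial observable, uniform integrability
from the in-tree exponential moment bound (CEHR (3.4), `LangevinChainExpBound`) and `e^{θH} ∈ L¹(π_T)`
(`pinnedChain_integrable_exp_mul_gibbsDensity`), dominated convergence. True for the harmonic member too. -/
theorem stub_autocorrelationContinuous :
    ∀ ω₂ lam β γ : ℝ, 0 < ω₂ → 0 < lam → 0 < β → 0 < γ → ∀ T : ℝ, 0 < T →
    ∀ C : ℕ → ℝ → ℝ,
      C = (fun (N : ℕ) (s : ℝ) => ∫ x, (∑ i : Fin N, (pinnedChain ω₂ lam β γ).bondCurrent N i x) *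
            (∫ y, (∑ i : Fin N, (pinnedChain ω₂ lam β γ).bondCurrent N i y)
              ∂((pinnedChain ω₂ lam β γ).transitionKernel N T T s.toNNReal x))
            ∂((pinnedChain ω₂ lam β γ).gibbsMeasure N T)) →
      ∀ N : ℕ, Continuous (C N) := by
  sorry

/-- **stub 2 · `stub_extensiveFisherBudget` — the static input: extensive `χ²`/Fisher budget of the steady
state RELATIVE TO GIBBS (size L; the card's `QuadraticNessEntropy`, in the `χ²` form the lever consumes).**
Under weak-NESS uniqueness, along every steady-state family, for `T > 0`: `∃ F` such that for every `N`,
eventually as `δ → 0` (`δ ≠ 0`), `χ²(μ_{N,T+δ/2,T-δ/2} ‖ π_T^N) ≤ F·N·δ²` (`Literature.Probability.Entropy.chiSqDiv`,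
`= ∫(dμ_δ/dπ_T - 1)² dπ_T`, `= ∞` unless `μ_δ ≪ π_T`). Reading: `limsup δ⁻²χ² = ‖h_N‖²_{L²(π_T)}`, the full
(even + odd) linear-response density; local equilibrium makes the even part `≈ T⁻²Σ_x θ(x/N)(e_x - ⟨e_x⟩)`
with `‖·‖² = O(N)` by static clustering of the 1-D Gibbs state, and the odd part is `½K_N` of
BondHeatUncertainty's (K) (`K_odd ≤ 4K'`, T2) — so this is (K) plus an even, static, extensive term. Harmonic
member: `K'_N = F_N/2 = 0.153, 0.223, 0.272, 0.316, 0.358` for `N = 2..6` at `(1,0,0,1)`, `T = 1` (T2's exact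
Gaussian table): extensive. `N = 0, 1`: `μ_δ = π_T` (a point; one site driven by two noises of mean
temperature `T`), `χ² = 0`. Why it might fail: long-range NESS pair correlations making `‖h_N‖²` superlinear;
at fixed `N`, `dμ_δ/dπ_T ∈ L²(π_T)` needs Gibbs-type two-sided density bounds for small `δ` (hot end:
`ρ_δ/ρ_T ~ e^{+δH_loc/2T²}`, square-integrable only for `δ < T` — the statement is local in `δ`). -/
theorem stub_extensiveFisherBudget :
    ∀ ω₂ lam β γ : ℝ, 0 < ω₂ → 0 < lam → 0 < β → 0 < γ →
    (∀ (N : ℕ) (T_L T_R : ℝ), 0 < T_L → 0 < T_R → ∀ μ ν : Measure (PhaseSpace N),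
      (pinnedChain ω₂ lam β γ).IsSteadyState N T_L T_R μ →
      (pinnedChain ω₂ lam β γ).IsSteadyState N T_L T_R ν → μ = ν) →
    ∀ μ : (N : ℕ) → ℝ → ℝ → Measure (PhaseSpace N),
      (∀ (N : ℕ) (T_L T_R : ℝ), 0 < T_L → 0 < T_R →
        (pinnedChain ω₂ lam β γ).IsSteadyState N T_L T_R (μ N T_L T_R)) →
    ∀ T : ℝ, 0 < T →
      ∃ F : ℝ, ∀ N : ℕ, ∀ᶠ δ in 𝓝[≠] (0 : ℝ),
        Literature.Probability.Entropy.chiSqDiv (μ N (T + δ / 2) (T - δ / 2))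
            ((pinnedChain ω₂ lam β γ).gibbsMeasure N T) ≤
          ENNReal.ofReal (F * (N : ℝ) * δ ^ 2) := by
  sorry

/-- **stub 3 · `stub_transitEntropyBound` — THE LEVER: Girsanov against the equal-noise Gibbs reference +
Hammersley–Chapman–Robbins at order `δ²` (size L, fixed `N`; the card's `EntropyTransitBoundTotal`, stated at
EVERY `τ > 0` per the T3 sharpening).** Under weak-NESS uniqueness, along every steady-state family, for
`T > 0`, response coefficients `D` (the `δ`-limits of clause (ii)), `N ≥ 2`, the equilibrium total-current
autocorrelation `C N` (pinned by its defining equation and ASSUMED continuous — stub 1), every `τ > 0` and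
every `F ≥ 0` with `χ²(μ_δ ‖ π_T) ≤ Fδ²` eventually:
`(D_N τ)² ≤ Var_eq(Φ_τ) · (F + γτ/(4T²))`, `Var_eq(Φ_τ) = 2∫₀^τ(τ-s) C_N(s) ds`.
Mechanism (re-derived independently by all three triagers): reference `Q^δ` = Gibbs start + baths with noise
`2γ(T±δ/2)` and frictions `γ(1 ± δ/2T)` (`π_T`-invariant, same diffusion as the NESS dynamics); HCR
`(E_PΦ - E_QΦ)² ≤ Var_Q(Φ)·χ²(P‖Q)` with `E_QΦ_τ = 0` (oddness, `pinnedChain_totalCurrent_gibbsMeasure`),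
`E_PΦ_τ = τ·totalCurrent μ_δ` (kernel-invariance of the unique weak steady state);
`1 + χ²(P^δ‖Q^δ) = ∫ r_δ² m_δ dπ_T` with `r_δ = dμ_δ/dπ_T`, `m_δ(x) = E_x[Z_τ²] = 1 + δ²·Σ_c γ/(8T²T_c)·E_x∫₀^τ p_c² + o(δ²)`
(exponential moments of `δ²∫₀^τ H` from CEHR (3.4)), whence `limsup δ⁻²χ²(P^δ‖Q^δ) ≤ F + γτ/(4T²)`;
`Var_{Q^δ}(Φ_τ) → Var_eq(Φ_τ)` (continuity in the contact frictions). Saturation checks (T2, harmonic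
`N = 2..6`): `τ → 0` corner = Cauchy–Schwarz `D_N² ≤ Var_π(J_tot)‖h_N‖²`; `τ → ∞` corner = the contact identity
`G_N ≤ γ/2`; ratio RHS/LHS ≥ 1.10 everywhere. `0 ≤ F` excludes the junk corner `F < -γτ/(4T²)`. -/
theorem stub_transitEntropyBound :
    ∀ ω₂ lam β γ : ℝ, 0 < ω₂ → 0 < lam → 0 < β → 0 < γ →
    (∀ (N : ℕ) (T_L T_R : ℝ), 0 < T_L → 0 < T_R → ∀ μ ν : Measure (PhaseSpace N),
      (pinnedChain ω₂ lam β γ).IsSteadyState N T_L T_R μ →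
      (pinnedChain ω₂ lam β γ).IsSteadyState N T_L T_R ν → μ = ν) →
    ∀ μ : (N : ℕ) → ℝ → ℝ → Measure (PhaseSpace N),
      (∀ (N : ℕ) (T_L T_R : ℝ), 0 < T_L → 0 < T_R →
        (pinnedChain ω₂ lam β γ).IsSteadyState N T_L T_R (μ N T_L T_R)) →
    ∀ T : ℝ, 0 < T → ∀ D : ℕ → ℝ,
      (∀ N : ℕ, Tendsto (fun δ : ℝ =>
        (pinnedChain ω₂ lam β γ).totalCurrent (μ N (T + δ / 2) (T - δ / 2)) / δ) (𝓝[≠] 0) (𝓝 (D N))) →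
    ∀ C : ℕ → ℝ → ℝ,
      C = (fun (N : ℕ) (s : ℝ) => ∫ x, (∑ i : Fin N, (pinnedChain ω₂ lam β γ).bondCurrent N i x) *
            (∫ y, (∑ i : Fin N, (pinnedChain ω₂ lam β γ).bondCurrent N i y)
              ∂((pinnedChain ω₂ lam β γ).transitionKernel N T T s.toNNReal x))
            ∂((pinnedChain ω₂ lam β γ).gibbsMeasure N T)) →
    ∀ N : ℕ, 2 ≤ N → Continuous (C N) →
    ∀ τ : ℝ, 0 < τ → ∀ F : ℝ, 0 ≤ F →
      (∀ᶠ δ in 𝓝[≠] (0 : ℝ),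
        Literature.Probability.Entropy.chiSqDiv (μ N (T + δ / 2) (T - δ / 2))
            ((pinnedChain ω₂ lam β γ).gibbsMeasure N T) ≤ ENNReal.ofReal (F * δ ^ 2)) →
      (D N * τ) ^ 2 ≤ (2 * ∫ s in (0 : ℝ)..τ, (τ - s) * C N s) * (F + γ * τ / (4 * T ^ 2)) := by
  sorry

/-- **stub 4 · `stub_subballisticTransitWindow` — the TRANSFERRED CRUX `C⁺` (size XL, hardest; the only stub
that uses anharmonicity).** For the pinned anharmonic chain (all parameters `> 0`) and `T > 0`: there is a
window constant `a > 0` such that for every `ε > 0`, for all long enough chains, at SOME time `0 < τ ≤ aN` the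
equilibrium variance of the time-integrated total current is sub-ballistic, `Var_eq(Φ_τ) ≤ ε·N·τ²`.
Why EASIER than the crux: an EQUILIBRIUM statement (Gibbs start, equal bath temperatures) about ONE second
moment at ONE finite time — no steady state, no response theory, no `N`-uniform rate; it contains both natural
witnesses: (i) FIXED `τ = τ(ε)` (the twin's `SubBallisticTotalCurrent`: finite-time locality
`Var_eq(Φ_τ)/N → τ²B_τ²` for the quartic chain + zero Drude weight `B_τ² → D(T) = 0` of the infinite pinned
chain, von Neumann/Mazur–Suzuki in `ℋ₀`), and (ii) the transit witness `τ = aN` (Cesàro-2 light-cone Drude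
weight of the open chain). Under Fourier phenomenology `Var_eq(Φ_τ)/(Nτ²) ≈ 2T²κ/τ`, so (i) holds with
`τ ≈ 2T²κ/ε`. FALSE at `lam = β = 0` for every `a` (ballistic plateau `¼Var(Q₁)τ²/N ≍ τ²` for `τ ≲ N/γ`, then
`≍ Nτ`; both `≥ c(a)Nτ²` on `τ ≤ aN`) — this is where `not_nonBallisticFor_harmonic` is honoured. Why it might
fail: an odd quasi-conserved `ℋ₀`-charge overlapping `J_tot` (positive Drude weight: Mazur1969; near-integrable
low-`T` ray `T·(lam, β) → 0`, where `N₀`, `τ` must blow up like the mean free path `(lamT)⁻²`) — then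
FouriersLaw itself fails; proof-wise `D(T) = 0` for a deterministic anharmonic chain is open
(MacroErgodicityHypothesis bites in substance; HasBoundedResponse is replaced by an equilibrium statement, not
evaded). -/
theorem stub_subballisticTransitWindow :
    ∀ ω₂ lam β γ : ℝ, 0 < ω₂ → 0 < lam → 0 < β → 0 < γ → ∀ T : ℝ, 0 < T →
    ∀ C : ℕ → ℝ → ℝ,
      C = (fun (N : ℕ) (s : ℝ) => ∫ x, (∑ i : Fin N, (pinnedChain ω₂ lam β γ).bondCurrent N i x) *
            (∫ y, (∑ i : Fin N, (pinnedChain ω₂ lam β γ).bondCurrent N i y)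
              ∂((pinnedChain ω₂ lam β γ).transitionKernel N T T s.toNNReal x))
            ∂((pinnedChain ω₂ lam β γ).gibbsMeasure N T)) →
      ∃ a : ℝ, 0 < a ∧ ∀ ε : ℝ, 0 < ε → ∃ N₀ : ℕ, ∀ N : ℕ, N₀ ≤ N →
        ∃ τ : ℝ, 0 < τ ∧ τ ≤ a * (N : ℝ) ∧
          (2 * ∫ s in (0 : ℝ)..τ, (τ - s) * C N s) ≤ ε * (N : ℝ) * τ ^ 2 := by
  sorry

/-! ## Name-keyed aliases of the four statements (the hypothesis types of the composition)

`Registered.stub_<name>` is VERBATIM the statement of `stub_<name>` (the wiring `example` at the end checks it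
definitionally); the skeleton audit admits a `Prop` hypothesis whose head constant carries a stub's name. -/
namespace Registered

/-- Verbatim statement of `stub_autocorrelationContinuous`. -/
abbrev stub_autocorrelationContinuous : Prop :=
    ∀ ω₂ lam β γ : ℝ, 0 < ω₂ → 0 < lam → 0 < β → 0 < γ → ∀ T : ℝ, 0 < T →
    ∀ C : ℕ → ℝ → ℝ,
      C = (fun (N : ℕ) (s : ℝ) => ∫ x, (∑ i : Fin N, (pinnedChain ω₂ lam β γ).bondCurrent N i x) *
            (∫ y, (∑ i : Fin N, (pinnedChain ω₂ lam β γ).bondCurrent N i y)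
              ∂((pinnedChain ω₂ lam β γ).transitionKernel N T T s.toNNReal x))
            ∂((pinnedChain ω₂ lam β γ).gibbsMeasure N T)) →
      ∀ N : ℕ, Continuous (C N)

/-- Verbatim statement of `stub_extensiveFisherBudget`. -/
abbrev stub_extensiveFisherBudget : Prop :=
    ∀ ω₂ lam β γ : ℝ, 0 < ω₂ → 0 < lam → 0 < β → 0 < γ →
    (∀ (N : ℕ) (T_L T_R : ℝ), 0 < T_L → 0 < T_R → ∀ μ ν : Measure (PhaseSpace N),
      (pinnedChain ω₂ lam β γ).IsSteadyState N T_L T_R μ →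
      (pinnedChain ω₂ lam β γ).IsSteadyState N T_L T_R ν → μ = ν) →
    ∀ μ : (N : ℕ) → ℝ → ℝ → Measure (PhaseSpace N),
      (∀ (N : ℕ) (T_L T_R : ℝ), 0 < T_L → 0 < T_R →
        (pinnedChain ω₂ lam β γ).IsSteadyState N T_L T_R (μ N T_L T_R)) →
    ∀ T : ℝ, 0 < T →
      ∃ F : ℝ, ∀ N : ℕ, ∀ᶠ δ in 𝓝[≠] (0 : ℝ),
        Literature.Probability.Entropy.chiSqDiv (μ N (T + δ / 2) (T - δ / 2))
            ((pinnedChain ω₂ lam β γ).gibbsMeasure N T) ≤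
          ENNReal.ofReal (F * (N : ℝ) * δ ^ 2)

/-- Verbatim statement of `stub_transitEntropyBound`. -/
abbrev stub_transitEntropyBound : Prop :=
    ∀ ω₂ lam β γ : ℝ, 0 < ω₂ → 0 < lam → 0 < β → 0 < γ →
    (∀ (N : ℕ) (T_L T_R : ℝ), 0 < T_L → 0 < T_R → ∀ μ ν : Measure (PhaseSpace N),
      (pinnedChain ω₂ lam β γ).IsSteadyState N T_L T_R μ →
      (pinnedChain ω₂ lam β γ).IsSteadyState N T_L T_R ν → μ = ν) →
    ∀ μ : (N : ℕ) → ℝ → ℝ → Measure (PhaseSpace N),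
      (∀ (N : ℕ) (T_L T_R : ℝ), 0 < T_L → 0 < T_R →
        (pinnedChain ω₂ lam β γ).IsSteadyState N T_L T_R (μ N T_L T_R)) →
    ∀ T : ℝ, 0 < T → ∀ D : ℕ → ℝ,
      (∀ N : ℕ, Tendsto (fun δ : ℝ =>
        (pinnedChain ω₂ lam β γ).totalCurrent (μ N (T + δ / 2) (T - δ / 2)) / δ) (𝓝[≠] 0) (𝓝 (D N))) →
    ∀ C : ℕ → ℝ → ℝ,
      C = (fun (N : ℕ) (s : ℝ) => ∫ x, (∑ i : Fin N, (pinnedChain ω₂ lam β γ).bondCurrent N i x) *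
            (∫ y, (∑ i : Fin N, (pinnedChain ω₂ lam β γ).bondCurrent N i y)
              ∂((pinnedChain ω₂ lam β γ).transitionKernel N T T s.toNNReal x))
            ∂((pinnedChain ω₂ lam β γ).gibbsMeasure N T)) →
    ∀ N : ℕ, 2 ≤ N → Continuous (C N) →
    ∀ τ : ℝ, 0 < τ → ∀ F : ℝ, 0 ≤ F →
      (∀ᶠ δ in 𝓝[≠] (0 : ℝ),
        Literature.Probability.Entropy.chiSqDiv (μ N (T + δ / 2) (T - δ / 2))
            ((pinnedChain ω₂ lam β γ).gibbsMeasure N T) ≤ ENNReal.ofReal (F * δ ^ 2)) →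
      (D N * τ) ^ 2 ≤ (2 * ∫ s in (0 : ℝ)..τ, (τ - s) * C N s) * (F + γ * τ / (4 * T ^ 2))

/-- Verbatim statement of `stub_subballisticTransitWindow`. -/
abbrev stub_subballisticTransitWindow : Prop :=
    ∀ ω₂ lam β γ : ℝ, 0 < ω₂ → 0 < lam → 0 < β → 0 < γ → ∀ T : ℝ, 0 < T →
    ∀ C : ℕ → ℝ → ℝ,
      C = (fun (N : ℕ) (s : ℝ) => ∫ x, (∑ i : Fin N, (pinnedChain ω₂ lam β γ).bondCurrent N i x) *
            (∫ y, (∑ i : Fin N, (pinnedChain ω₂ lam β γ).bondCurrent N i y)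
              ∂((pinnedChain ω₂ lam β γ).transitionKernel N T T s.toNNReal x))
            ∂((pinnedChain ω₂ lam β γ).gibbsMeasure N T)) →
      ∃ a : ℝ, 0 < a ∧ ∀ ε : ℝ, 0 < ε → ∃ N₀ : ℕ, ∀ N : ℕ, N₀ ≤ N →
        ∃ τ : ℝ, 0 < τ ∧ τ ≤ a * (N : ℝ) ∧
          (2 * ∫ s in (0 : ℝ)..τ, (τ - s) * C N s) ≤ ε * (N : ℝ) * τ ^ 2

end Registered

/-! ## The composition: the four stubs give the crux BY NAME (no `sorry` below) -/

/-- **`NonBallistic_of`** — kernel-checked composition of the line. Fix parameters, a steady-state family, `T`,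
`D`, `ε > 0`, `N₀`. Stub 2 gives the budget constant `F` (made `≥ 0`), stub 4 the window `a`; put
`M := F⁺ + γa/(4T²)` and `ε' := ε²/(4(M+1))`; stub 4 at `ε'` gives `N₁` and, at `N := max(N₀, N₁, 2)`, a time
`0 < τ ≤ aN` with `Var_eq(Φ_τ) ≤ ε'Nτ²`; stub 3 (fed with stub 1's continuity and stub 2's eventual bound with
constant `F⁺N`) gives `(D_Nτ)² ≤ Var_eq(Φ_τ)(F⁺N + γτ/(4T²)) ≤ ε'Nτ² · N·M`, i.e. `D_N² ≤ ε'M N² ≤ (εN/2)²`, so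
`D_N ≤ εN/2 ≤ ε(N-1)` (`N ≥ 2`; the case `D_N ≤ 0` is immediate). No sign information on the variance is used
(the factor it multiplies is `≥ 0`). -/
theorem NonBallistic_of
    (hA : Registered.stub_autocorrelationContinuous) (hB : Registered.stub_extensiveFisherBudget)
    (hC : Registered.stub_transitEntropyBound) (hD : Registered.stub_subballisticTransitWindow) :
    Summit.AtomisticToContinuum.FouriersLaw.Theses.JunctionLocality.NonBallistic := by
  intro ω₂ lam β γ hω hl hβ hγ huniq μ hμ T hT D hDlim ε hε N₀
  -- the equilibrium total-current autocorrelation, keyed once for all stubs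
  set Cf : ℕ → ℝ → ℝ := fun (N : ℕ) (s : ℝ) =>
      ∫ x, (∑ i : Fin N, (pinnedChain ω₂ lam β γ).bondCurrent N i x) *
        (∫ y, (∑ i : Fin N, (pinnedChain ω₂ lam β γ).bondCurrent N i y)
          ∂((pinnedChain ω₂ lam β γ).transitionKernel N T T s.toNNReal x))
        ∂((pinnedChain ω₂ lam β γ).gibbsMeasure N T) with hCf
  have hA' : ∀ N : ℕ, Continuous (Cf N) := hA ω₂ lam β γ hω hl hβ hγ T hT Cf hCf
  obtain ⟨F, hF⟩ := hB ω₂ lam β γ hω hl hβ hγ huniq μ hμ T hT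
  obtain ⟨a, ha, hDa⟩ := hD ω₂ lam β γ hω hl hβ hγ T hT Cf hCf
  have hC' := hC ω₂ lam β γ hω hl hβ hγ huniq μ hμ T hT D hDlim Cf hCf
  -- constants
  have hT2 : 0 < T ^ 2 := by positivity
  set Fp : ℝ := max F 0 with hFp
  have hFp0 : 0 ≤ Fp := le_max_right _ _
  have hFFp : F ≤ Fp := le_max_left _ _
  set M : ℝ := Fp + γ * a / (4 * T ^ 2) with hM
  have hM0 : 0 ≤ M := by positivity
  set ε' : ℝ := ε ^ 2 / (4 * (M + 1)) with hε'
  have hε'0 : 0 < ε' := by positivity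
  obtain ⟨N₁, hN₁⟩ := hDa ε' hε'0
  -- the length witnessing `D_N ≤ ε (N - 1)`
  refine ⟨max (max N₀ N₁) 2, le_trans (le_max_left _ _) (le_max_left _ _), ?_⟩
  set N : ℕ := max (max N₀ N₁) 2 with hNdef
  have hN₁N : N₁ ≤ N := le_trans (le_max_right _ _) (le_max_left _ _)
  have hN2 : 2 ≤ N := le_max_right _ _
  have hNr : (2 : ℝ) ≤ (N : ℝ) := by exact_mod_cast hN2
  have hNm1 : (0 : ℝ) ≤ (N : ℝ) - 1 := by linarith
  by_cases hDN : D N ≤ 0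
  · exact hDN.trans (mul_nonneg hε.le hNm1)
  push Not at hDN
  -- stub 4: a sub-ballistic time in the transit window at this `N`
  obtain ⟨τ, hτ, hτa, hV⟩ := hN₁ N hN₁N
  -- stub 2, with the constant enlarged to `Fp * N ≥ 0`
  have hev : ∀ᶠ δ in 𝓝[≠] (0 : ℝ),
      Literature.Probability.Entropy.chiSqDiv (μ N (T + δ / 2) (T - δ / 2))
          ((pinnedChain ω₂ lam β γ).gibbsMeasure N T) ≤ ENNReal.ofReal (Fp * (N : ℝ) * δ ^ 2) := by
    filter_upwards [hF N] with δ hδ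
    refine le_trans hδ (ENNReal.ofReal_le_ofReal ?_)
    have h2 : 0 ≤ (N : ℝ) * δ ^ 2 := by positivity
    nlinarith
  have hFN : 0 ≤ Fp * (N : ℝ) := by positivity
  -- stub 3 (fed with stub 1): the transit–entropy inequality at `(N, τ, Fp * N)`
  have hstar := hC' N hN2 (hA' N) τ hτ (Fp * (N : ℝ)) hFN hev
  set V : ℝ := 2 * ∫ s in (0 : ℝ)..τ, (τ - s) * Cf N s with hVdef
  -- real arithmetic
  have hfac0 : 0 ≤ Fp * (N : ℝ) + γ * τ / (4 * T ^ 2) := by positivity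
  have hfacM : Fp * (N : ℝ) + γ * τ / (4 * T ^ 2) ≤ (N : ℝ) * M := by
    have h1 : γ * τ / (4 * T ^ 2) ≤ γ * (a * (N : ℝ)) / (4 * T ^ 2) := by
      apply div_le_div_of_nonneg_right _ (by positivity)
      exact mul_le_mul_of_nonneg_left hτa hγ.le
    have h2 : (N : ℝ) * M = Fp * (N : ℝ) + γ * (a * (N : ℝ)) / (4 * T ^ 2) := by
      rw [hM]; ring
    linarith [h1, h2]
  have h1 : (D N * τ) ^ 2 ≤ ε' * (N : ℝ) * τ ^ 2 * ((N : ℝ) * M) :=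
    calc (D N * τ) ^ 2 ≤ V * (Fp * (N : ℝ) + γ * τ / (4 * T ^ 2)) := hstar
      _ ≤ ε' * (N : ℝ) * τ ^ 2 * (Fp * (N : ℝ) + γ * τ / (4 * T ^ 2)) :=
          mul_le_mul_of_nonneg_right hV hfac0
      _ ≤ ε' * (N : ℝ) * τ ^ 2 * ((N : ℝ) * M) :=
          mul_le_mul_of_nonneg_left hfacM (by positivity)
  have h2 : (D N) ^ 2 ≤ ε' * M * (N : ℝ) ^ 2 := by
    have hτ2 : 0 < τ ^ 2 := by positivity
    have h1' : (D N) ^ 2 * τ ^ 2 ≤ (ε' * M * (N : ℝ) ^ 2) * τ ^ 2 := by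
      have e1 : (D N) ^ 2 * τ ^ 2 = (D N * τ) ^ 2 := by ring
      have e2 : (ε' * M * (N : ℝ) ^ 2) * τ ^ 2 = ε' * (N : ℝ) * τ ^ 2 * ((N : ℝ) * M) := by ring
      rw [e1, e2]; exact h1
    exact le_of_mul_le_mul_right h1' hτ2
  have h3 : ε' * M ≤ ε ^ 2 / 4 := by
    rw [hε', div_mul_eq_mul_div, div_le_div_iff₀ (by positivity) (by positivity)]
    nlinarith [sq_nonneg ε, hM0]
  have h4 : (D N) ^ 2 ≤ (ε * (N : ℝ) / 2) ^ 2 :=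
    calc (D N) ^ 2 ≤ ε' * M * (N : ℝ) ^ 2 := h2
      _ ≤ ε ^ 2 / 4 * (N : ℝ) ^ 2 := mul_le_mul_of_nonneg_right h3 (by positivity)
      _ = (ε * (N : ℝ) / 2) ^ 2 := by ring
  have h5 : D N ≤ ε * (N : ℝ) / 2 :=
    (pow_le_pow_iff_left₀ hDN.le (by positivity) two_ne_zero).mp h4
  have h6 : ε * (N : ℝ) / 2 ≤ ε * ((N : ℝ) - 1) := by nlinarith [hNr, hε]
  exact h5.trans h6

/-- Wiring check: the four registered stubs feed `NonBallistic_of` exactly as stated (their verbatim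
statements are definitionally the `Registered.*` aliases). An `example`, so that `NonBallistic_of` stays the
only theorem of the file concluding the crux. -/
example : Summit.AtomisticToContinuum.FouriersLaw.Theses.JunctionLocality.NonBallistic :=
  NonBallistic_of stub_autocorrelationContinuous stub_extensiveFisherBudget stub_transitEntropyBound
    stub_subballisticTransitWindow

end Summit.AtomisticToContinuum.FouriersLaw.Cruxes.NonBallistic.TransitEntropyPairing

end
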